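import Literature.NumberTheory.LFunctions.TaoLogElliottHoeffding
import Literature.NumberTheory.LFunctions.TaoLogElliottEndgame
import Literature.NumberTheory.LFunctions.TaoLogElliottDiscretisation
import HarnessLib

/-!
# Tao's log-averaged Elliott theorem: the bilinear form `F(x, y)` under perturbation of `x`

Part of the proof DAG below the named fact `Literature.NumberTheory.LFunctions.Tao2016_theorem23_core` (Tao, Forum Math. Pi 4
(2016) e8, proof of Theorem 2.3).  In §2 of the paper the sequences `g₁, g₂` are replaced by
their discretisations `g_{i,ε²}` ("`gᵢ` rounded to the nearest element of the lattice `ε² ℤ[i]`,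
so that `g_{i,ε²} = gᵢ + O(ε²)` and `g_{i,ε²}` takes `O_ε(1)` values"), at a cost which is
linear in the rounding error because the bilinear expression
`F(x, y) = ∑_{p ∈ 𝒫_H} c_p ∑_j 1_{ay + j ≡ pb (ap)} x_{1,j} x_{2,j+ph}` (`Literature.NumberTheory.LFunctions.Tao2016.Fbil`,
`Literature.NumberTheory.LFunctions.Tao2016.Floc`) and its local mean `∑_p (c_p/p) ∑_j 1_{j ≡ pb (a)} x_{1,j} x_{2,j+ph}`
(`Literature.NumberTheory.LFunctions.Tao2016.bilinC`, `Literature.NumberTheory.LFunctions.Tao2016.FlocMean`) are bilinear in `(x₁, x₂)` with few nonzero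
terms; and in §3, after (3.14), the discretisation is undone again ("we can replace `g_{i,ε²}`
by `gᵢ` … at the cost of `O(ε² ∑_p H/p)`").  This file proves these bookkeeping estimates, with
explicit constants, for arbitrary pairs of sequences `x, x'` close on `[1, H]`:

* `Floc_congr`, `FlocMean_congr`, `Fbil_congr`, `bilinC_congr` — the forms only see `x|[1,H]`;
* `norm_Floc_sub_Floc_le`, `norm_Fbil_sub_Fbil_le` — `|F_p(x,z) - F_p(x',z)| ≤ |c_p| (B₁δ₂ + δ₁B₂)(H/p + 1)`;
* `norm_FlocMean_sub_FlocMean_le`, `norm_bilinC_sub_bilinC_le` — the same for the means, with `H/p`;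
* `norm_Fbil_le_sum`, `norm_bilinC_le_sum` — the crude size bounds `F(x,y), ∑_p mean ≪ ∑_p (H/p + 1)`
  ("`F(x, y) ≪ H / log H`", proof of Theorem 2.3 after Lemma 3.5);
* `norm_seqAt_sub_seqAt_round_le`, `norm_seqAt_round_le` — the rows `x_{i,j}(𝐧) = gᵢ(a𝐧 + j)` and
  their roundings differ by `≤ δ` and the rounded rows are `≤ 1 + δ` in modulus
  (`Literature.StatMech.meshPoint ∘ Literature.StatMech.nearestSite`, `TaoLogElliottDiscretisation.lean`);
* `intCast_add_eq_zero_iff_dvd`, `card_filter_range_natCast_le` — reading the constraint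
  `p ∣ a n + j` in `ℤ/pℤ` and events on `{0, …, P-1}` in `ℤ/Pℤ` (glue for Lemma 3.5).

## References
* T. Tao, Forum Math. Pi 4 (2016), e8; arXiv:1509.05422, §2 (the paragraph after the proof of
  Proposition 2.6) and §3 (the paragraph after (3.14)).
-/

open Finset Real Complex

namespace Literature.NumberTheory.LFunctions

namespace Tao2016

open Literature.Probability.LatticeModels

/-! ### Elementary inequalities -/

/-- `|uv - u'v'| ≤ |u| |v - v'| + |u - u'| |v'| ≤ B₁ δ₂ + δ₁ B₂`. [folklore] -/
theorem norm_mul_sub_mul_le_of_bounds {u v u' v' : ℂ} {B₁ B₂ δ₁ δ₂ : ℝ} (hu : ‖u‖ ≤ B₁)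
    (hv' : ‖v'‖ ≤ B₂) (hdu : ‖u - u'‖ ≤ δ₁) (hdv : ‖v - v'‖ ≤ δ₂) :
    ‖u * v - u' * v'‖ ≤ B₁ * δ₂ + δ₁ * B₂ := by
  have hB₁ : 0 ≤ B₁ := (norm_nonneg _).trans hu
  have hδ₁ : 0 ≤ δ₁ := (norm_nonneg _).trans hdu
  have : u * v - u' * v' = u * (v - v') + (u - u') * v' := by ring
  rw [this]
  refine (norm_add_le _ _).trans ?_
  rw [norm_mul, norm_mul]
  exact add_le_add (mul_le_mul hu hdv (norm_nonneg _) hB₁)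
    (mul_le_mul hdu hv' (norm_nonneg _) hδ₁)

/-- The constraint `a z + j = 0` in `ℤ/pℤ` at `z = n mod p` is `p ∣ a n + j`. [folklore] -/
theorem natCast_mul_natCast_add_intCast_eq_zero_iff (p a n : ℕ) (j : ℤ) :
    (a : ZMod p) * (n : ZMod p) + (j : ZMod p) = 0 ↔ (p : ℤ) ∣ (a * n : ℕ) + j := by
  rw [← ZMod.intCast_zmod_eq_zero_iff_dvd]
  push_cast
  exact Iff.rfl

/-- An event read on the representatives `{0, …, P-1}` is at most as large as the same event on
`ℤ/Pℤ` (the map `y ↦ y mod P` is injective on `{0, …, P-1}`). [folklore] -/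
theorem card_filter_range_natCast_le {P : ℕ} [NeZero P] (Q : ZMod P → Prop) [DecidablePred Q] :
    ((range P).filter fun y : ℕ => Q (y : ZMod P)).card ≤ (univ.filter Q).card := by
  refine card_le_card_of_injOn (fun y : ℕ => (y : ZMod P)) (fun y hy => ?_) ?_
  · simp only [coe_filter, Set.mem_setOf_eq, mem_univ, true_and] at hy ⊢
    exact hy.2
  · intro y₁ h₁ y₂ h₂ heq
    simp only [coe_filter, Set.mem_setOf_eq, mem_range] at h₁ h₂
    have e := (ZMod.natCast_eq_natCast_iff' y₁ y₂ P).1 heq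
    rwa [Nat.mod_eq_of_lt h₁.1, Nat.mod_eq_of_lt h₂.1] at e

/-! ### The forms only depend on `x|[1, H]` -/

section Forms

variable {a H : ℕ} {b h : ℤ} {c : ℕ → ℂ}

/-- `j ∈ jRange` forces `j, j + ph ∈ [1, H]`. [folklore] -/
theorem mem_Icc_of_mem_jRange {p : ℕ} {j : ℤ} (hj : j ∈ jRange a H b h p) :
    j ∈ Icc (1 : ℤ) H ∧ j + p * h ∈ Icc (1 : ℤ) H := by
  unfold jRange at hj
  simp only [mem_filter] at hj
  exact ⟨hj.1, hj.2.1⟩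

/-- `F_p(x, z)` only depends on `x|[1, H]`. [folklore] -/
theorem Floc_congr {x₁ x₂ x₁' x₂' : ℤ → ℂ} (h₁ : ∀ j ∈ Icc (1 : ℤ) H, x₁ j = x₁' j)
    (h₂ : ∀ j ∈ Icc (1 : ℤ) H, x₂ j = x₂' j) (p : ℕ) (z : ZMod p) :
    Floc a H b h c x₁ x₂ p z = Floc a H b h c x₁' x₂' p z := by
  unfold Floc
  congr 1
  refine sum_congr rfl fun j hj => ?_
  obtain ⟨hj1, hj2⟩ := mem_Icc_of_mem_jRange hj
  rw [h₁ j hj1, h₂ _ hj2]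

/-- The mean of `F_p(x, ·)` only depends on `x|[1, H]`. [folklore] -/
theorem FlocMean_congr {x₁ x₂ x₁' x₂' : ℤ → ℂ} (h₁ : ∀ j ∈ Icc (1 : ℤ) H, x₁ j = x₁' j)
    (h₂ : ∀ j ∈ Icc (1 : ℤ) H, x₂ j = x₂' j) (p : ℕ) :
    FlocMean a H b h c x₁ x₂ p = FlocMean a H b h c x₁' x₂' p := by
  unfold FlocMean
  congr 1
  refine sum_congr rfl fun j hj => ?_
  obtain ⟨hj1, hj2⟩ := mem_Icc_of_mem_jRange hj
  rw [h₁ j hj1, h₂ _ hj2]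

/-- `F(x, y)` only depends on `x|[1, H]`. [folklore] -/
theorem Fbil_congr {x₁ x₂ x₁' x₂' : ℤ → ℂ} (h₁ : ∀ j ∈ Icc (1 : ℤ) H, x₁ j = x₁' j)
    (h₂ : ∀ j ∈ Icc (1 : ℤ) H, x₂ j = x₂' j) (Pr : Finset ℕ) {P : ℕ} (y : ZMod P) :
    Fbil a H b h c x₁ x₂ Pr y = Fbil a H b h c x₁' x₂' Pr y :=
  sum_congr rfl fun p _ => Floc_congr h₁ h₂ p _

/-- `bilinC` (the sum of the local means) only depends on `x|[1, H]`. [folklore] -/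
theorem bilinC_congr {x₁ x₂ x₁' x₂' : ℤ → ℂ} (h₁ : ∀ j ∈ Icc (1 : ℤ) H, x₁ j = x₁' j)
    (h₂ : ∀ j ∈ Icc (1 : ℤ) H, x₂ j = x₂' j) (Pr : Finset ℕ) :
    bilinC H a b h Pr c x₁ x₂ = bilinC H a b h Pr c x₁' x₂' := by
  rw [← sum_FlocMean_eq_bilinC, ← sum_FlocMean_eq_bilinC]
  exact sum_congr rfl fun p _ => FlocMean_congr h₁ h₂ p

/-! ### Perturbation in `x` -/

/-- **Discretisation cost, one prime** (Tao 2016, §2, after Proposition 2.6): if `|x₁| ≤ B₁`,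
`|x₂'| ≤ B₂`, `|x₁ - x₁'| ≤ δ₁`, `|x₂ - x₂'| ≤ δ₂` on `[1, H]`, then
`|F_p(x, z) - F_p(x', z)| ≤ |c_p| (B₁ δ₂ + δ₁ B₂) (H/p + 1)` (at most `H/p + 1` indices `j`
satisfy the constraint `p ∣ az + j`).
[cite: TaoFMP2016, §2 (paragraph after the proof of Proposition 2.6)] -/
theorem norm_Floc_sub_Floc_le {p : ℕ} (hp : 0 < p) {B₁ B₂ δ₁ δ₂ : ℝ} (hB₁ : 0 ≤ B₁) (hB₂ : 0 ≤ B₂)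
    (hδ₁ : 0 ≤ δ₁) (hδ₂ : 0 ≤ δ₂) {x₁ x₂ x₁' x₂' : ℤ → ℂ}
    (hx₁ : ∀ j ∈ Icc (1 : ℤ) H, ‖x₁ j‖ ≤ B₁) (hx₂' : ∀ j ∈ Icc (1 : ℤ) H, ‖x₂' j‖ ≤ B₂)
    (hd₁ : ∀ j ∈ Icc (1 : ℤ) H, ‖x₁ j - x₁' j‖ ≤ δ₁)
    (hd₂ : ∀ j ∈ Icc (1 : ℤ) H, ‖x₂ j - x₂' j‖ ≤ δ₂) (z : ZMod p) :
    ‖Floc a H b h c x₁ x₂ p z - Floc a H b h c x₁' x₂' p z‖ ≤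
      ‖c p‖ * ((B₁ * δ₂ + δ₁ * B₂) * ((H : ℝ) / p + 1)) := by
  set K : ℝ := B₁ * δ₂ + δ₁ * B₂ with hK
  have hK0 : 0 ≤ K := by positivity
  have hsub : Floc a H b h c x₁ x₂ p z - Floc a H b h c x₁' x₂' p z =
      c p * ∑ j ∈ jRange a H b h p, (if (a : ZMod p) * z + (j : ZMod p) = 0 then
        x₁ j * x₂ (j + p * h) - x₁' j * x₂' (j + p * h) else 0) := by
    unfold Floc
    rw [← mul_sub, ← sum_sub_distrib]
    congr 1
    refine sum_congr rfl fun j _ => ?_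
    split_ifs <;> simp
  rw [hsub, norm_mul]
  gcongr
  calc ‖∑ j ∈ jRange a H b h p, (if (a : ZMod p) * z + (j : ZMod p) = 0 then
          x₁ j * x₂ (j + p * h) - x₁' j * x₂' (j + p * h) else 0)‖
      ≤ ∑ j ∈ jRange a H b h p, ‖(if (a : ZMod p) * z + (j : ZMod p) = 0 then
          x₁ j * x₂ (j + p * h) - x₁' j * x₂' (j + p * h) else 0)‖ := norm_sum_le _ _
    _ ≤ ∑ j ∈ Icc (1 : ℤ) H, (if (j : ZMod p) = -((a : ZMod p) * z) then K else 0) := by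
        refine sum_le_sum_of_subset_of_nonneg (filter_subset _ _) (fun j _ _ => by positivity)
          |>.trans' (sum_le_sum fun j hj => ?_)
        obtain ⟨hj1, hj2⟩ := mem_Icc_of_mem_jRange hj
        have hiff : (a : ZMod p) * z + (j : ZMod p) = 0 ↔ (j : ZMod p) = -((a : ZMod p) * z) := by
          rw [add_comm, add_eq_zero_iff_eq_neg]
        by_cases hcond : (a : ZMod p) * z + (j : ZMod p) = 0
        · rw [if_pos hcond, if_pos (hiff.1 hcond)]
          exact norm_mul_sub_mul_le_of_bounds (hx₁ j hj1) (hx₂' _ hj2) (hd₁ j hj1) (hd₂ _ hj2)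
        · rw [if_neg hcond, norm_zero]
          split_ifs <;> positivity
    _ = K * ((Icc (1 : ℤ) H).filter fun j : ℤ => (j : ZMod p) = -((a : ZMod p) * z)).card := by
        rw [← sum_filter, sum_const, nsmul_eq_mul, mul_comm]
    _ ≤ K * ((H : ℝ) / p + 1) := by
        gcongr
        have h1 := card_filter_intCast_eq_le H hp (-((a : ZMod p) * z))
        calc (((Icc (1 : ℤ) H).filter fun j : ℤ => (j : ZMod p) = -((a : ZMod p) * z)).card : ℝ)
            ≤ ((H / p + 1 : ℕ) : ℝ) := by exact_mod_cast h1
          _ ≤ (H : ℝ) / p + 1 := by push_cast; gcongr; exact Nat.cast_div_le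

/-- The same perturbation bound for the local mean:
`|mean F_p(x, ·) - mean F_p(x', ·)| ≤ |c_p| (B₁ δ₂ + δ₁ B₂) H / p`.
[cite: TaoFMP2016, §3 (paragraph after (3.14))] -/
theorem norm_FlocMean_sub_FlocMean_le {p : ℕ} (hp : 0 < p) {B₁ B₂ δ₁ δ₂ : ℝ} (hB₁ : 0 ≤ B₁)
    (hB₂ : 0 ≤ B₂) (hδ₁ : 0 ≤ δ₁) (hδ₂ : 0 ≤ δ₂) {x₁ x₂ x₁' x₂' : ℤ → ℂ}
    (hx₁ : ∀ j ∈ Icc (1 : ℤ) H, ‖x₁ j‖ ≤ B₁) (hx₂' : ∀ j ∈ Icc (1 : ℤ) H, ‖x₂' j‖ ≤ B₂)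
    (hd₁ : ∀ j ∈ Icc (1 : ℤ) H, ‖x₁ j - x₁' j‖ ≤ δ₁)
    (hd₂ : ∀ j ∈ Icc (1 : ℤ) H, ‖x₂ j - x₂' j‖ ≤ δ₂) :
    ‖FlocMean a H b h c x₁ x₂ p - FlocMean a H b h c x₁' x₂' p‖ ≤
      ‖c p‖ * ((B₁ * δ₂ + δ₁ * B₂) * ((H : ℝ) / p)) := by
  set K : ℝ := B₁ * δ₂ + δ₁ * B₂ with hK
  have hK0 : 0 ≤ K := by positivity
  have hp' : (0 : ℝ) < p := by exact_mod_cast hp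
  have hsub : FlocMean a H b h c x₁ x₂ p - FlocMean a H b h c x₁' x₂' p =
      c p / p * ∑ j ∈ jRange a H b h p, (x₁ j * x₂ (j + p * h) - x₁' j * x₂' (j + p * h)) := by
    unfold FlocMean
    rw [← mul_sub, ← sum_sub_distrib]
  rw [hsub, norm_mul, norm_div, Complex.norm_natCast]
  calc ‖c p‖ / p * ‖∑ j ∈ jRange a H b h p, (x₁ j * x₂ (j + p * h) - x₁' j * x₂' (j + p * h))‖
      ≤ ‖c p‖ / p * (H * K) := by
        gcongr
        calc ‖∑ j ∈ jRange a H b h p, (x₁ j * x₂ (j + p * h) - x₁' j * x₂' (j + p * h))‖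
            ≤ ∑ j ∈ jRange a H b h p, ‖x₁ j * x₂ (j + p * h) - x₁' j * x₂' (j + p * h)‖ :=
              norm_sum_le _ _
          _ ≤ ∑ j ∈ Icc (1 : ℤ) H, K := by
              refine (sum_le_sum fun j hj => ?_).trans
                (sum_le_sum_of_subset_of_nonneg (filter_subset _ _) fun _ _ _ => hK0)
              obtain ⟨hj1, hj2⟩ := mem_Icc_of_mem_jRange hj
              exact norm_mul_sub_mul_le_of_bounds (hx₁ j hj1) (hx₂' _ hj2) (hd₁ j hj1) (hd₂ _ hj2)
          _ = H * K := by simp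
    _ = ‖c p‖ * (K * ((H : ℝ) / p)) := by field_simp

/-- **Discretisation cost for `F(x, y)`**: summing `norm_Floc_sub_Floc_le` over `p ∈ 𝒫`.
[cite: TaoFMP2016, §2 (paragraph after the proof of Proposition 2.6)] -/
theorem norm_Fbil_sub_Fbil_le {Pr : Finset ℕ} (hPr : ∀ p ∈ Pr, 0 < p) {B₁ B₂ δ₁ δ₂ : ℝ}
    (hB₁ : 0 ≤ B₁) (hB₂ : 0 ≤ B₂) (hδ₁ : 0 ≤ δ₁) (hδ₂ : 0 ≤ δ₂) {x₁ x₂ x₁' x₂' : ℤ → ℂ}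
    (hx₁ : ∀ j ∈ Icc (1 : ℤ) H, ‖x₁ j‖ ≤ B₁) (hx₂' : ∀ j ∈ Icc (1 : ℤ) H, ‖x₂' j‖ ≤ B₂)
    (hd₁ : ∀ j ∈ Icc (1 : ℤ) H, ‖x₁ j - x₁' j‖ ≤ δ₁)
    (hd₂ : ∀ j ∈ Icc (1 : ℤ) H, ‖x₂ j - x₂' j‖ ≤ δ₂) {P : ℕ} (y : ZMod P) :
    ‖Fbil a H b h c x₁ x₂ Pr y - Fbil a H b h c x₁' x₂' Pr y‖ ≤
      ∑ p ∈ Pr, ‖c p‖ * ((B₁ * δ₂ + δ₁ * B₂) * ((H : ℝ) / p + 1)) := by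
  unfold Fbil
  rw [← sum_sub_distrib]
  exact (norm_sum_le _ _).trans (sum_le_sum fun p hp =>
    norm_Floc_sub_Floc_le (hPr p hp) hB₁ hB₂ hδ₁ hδ₂ hx₁ hx₂' hd₁ hd₂ _)

/-- **Undoing the discretisation in the local means** (Tao 2016, §3, after (3.14): "we can
replace `g_{i,ε²}` by `gᵢ` … at the cost of `O(ε² ∑_p H/p)`"):
`|bilinC(x) - bilinC(x')| ≤ ∑_p |c_p| (B₁ δ₂ + δ₁ B₂) H/p`.
[cite: TaoFMP2016, §3 (paragraph after (3.14))] -/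
theorem norm_bilinC_sub_bilinC_le {Pr : Finset ℕ} (hPr : ∀ p ∈ Pr, 0 < p) {B₁ B₂ δ₁ δ₂ : ℝ}
    (hB₁ : 0 ≤ B₁) (hB₂ : 0 ≤ B₂) (hδ₁ : 0 ≤ δ₁) (hδ₂ : 0 ≤ δ₂) {x₁ x₂ x₁' x₂' : ℤ → ℂ}
    (hx₁ : ∀ j ∈ Icc (1 : ℤ) H, ‖x₁ j‖ ≤ B₁) (hx₂' : ∀ j ∈ Icc (1 : ℤ) H, ‖x₂' j‖ ≤ B₂)
    (hd₁ : ∀ j ∈ Icc (1 : ℤ) H, ‖x₁ j - x₁' j‖ ≤ δ₁)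
    (hd₂ : ∀ j ∈ Icc (1 : ℤ) H, ‖x₂ j - x₂' j‖ ≤ δ₂) :
    ‖bilinC H a b h Pr c x₁ x₂ - bilinC H a b h Pr c x₁' x₂'‖ ≤
      ∑ p ∈ Pr, ‖c p‖ * ((B₁ * δ₂ + δ₁ * B₂) * ((H : ℝ) / p)) := by
  rw [← sum_FlocMean_eq_bilinC, ← sum_FlocMean_eq_bilinC, ← sum_sub_distrib]
  exact (norm_sum_le _ _).trans (sum_le_sum fun p hp =>
    norm_FlocMean_sub_FlocMean_le (hPr p hp) hB₁ hB₂ hδ₁ hδ₂ hx₁ hx₂' hd₁ hd₂)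

/-- **`F(x, y) ≪ ∑_p (H/p + 1)`** (Tao 2016, §3, proof of Theorem 2.3: "`F(x, y) ≪ H / log H`"
once `∑_{p ∈ 𝒫_H} 1/p ≪ 1/log H` and `#𝒫_H ≪ H / log H`).
[cite: TaoFMP2016, §3 (proof of Theorem 2.3, the bound F(x,y) ≪ H/log H)] -/
theorem norm_Fbil_le_sum {Pr : Finset ℕ} (hPr : ∀ p ∈ Pr, 0 < p) {B₁ B₂ : ℝ} (hB₁ : 0 ≤ B₁)
    (hB₂ : 0 ≤ B₂) {x₁ x₂ : ℤ → ℂ} (hx₁ : ∀ j ∈ Icc (1 : ℤ) H, ‖x₁ j‖ ≤ B₁)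
    (hx₂ : ∀ j ∈ Icc (1 : ℤ) H, ‖x₂ j‖ ≤ B₂) {P : ℕ} (y : ZMod P) :
    ‖Fbil a H b h c x₁ x₂ Pr y‖ ≤ ∑ p ∈ Pr, ‖c p‖ * (B₁ * B₂ * ((H : ℝ) / p + 1)) :=
  (norm_sum_le _ _).trans (sum_le_sum fun p hp => norm_Floc_le (hPr p hp) hB₁ hB₂ hx₁ hx₂ _)

/-- **`∑_p mean F_p(x, ·) ≪ ∑_p H/p`** (the size of `bilinC`). [folklore] -/
theorem norm_bilinC_le_sum {Pr : Finset ℕ} (hPr : ∀ p ∈ Pr, 0 < p) {B₁ B₂ : ℝ} (hB₁ : 0 ≤ B₁)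
    (hB₂ : 0 ≤ B₂) {x₁ x₂ : ℤ → ℂ} (hx₁ : ∀ j ∈ Icc (1 : ℤ) H, ‖x₁ j‖ ≤ B₁)
    (hx₂ : ∀ j ∈ Icc (1 : ℤ) H, ‖x₂ j‖ ≤ B₂) :
    ‖bilinC H a b h Pr c x₁ x₂‖ ≤ ∑ p ∈ Pr, ‖c p‖ * (B₁ * B₂ * ((H : ℝ) / p)) := by
  rw [← sum_FlocMean_eq_bilinC]
  exact (norm_sum_le _ _).trans (sum_le_sum fun p hp => norm_FlocMean_le (hPr p hp) hB₁ hB₂ hx₁ hx₂)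

end Forms

/-! ### The rows `x_{i,j}(𝐧) = gᵢ(a𝐧 + j)` and their roundings -/

/-- **`g_{i,ε²} = gᵢ + O(ε²)`** along a row: the rounded row
`j ↦ δ[gᵢ(m + j)/δ]` (`Literature.StatMech.meshPoint δ ∘ Literature.StatMech.nearestSite δ`) is within `δ` of
the row `seqAt gᵢ m`. [cite: TaoFMP2016, §2 (paragraph after the proof of Proposition 2.6)] -/
theorem norm_seqAt_sub_seqAt_round_le {δ : ℝ} (hδ : 0 < δ) (g : ℕ → ℂ) (m : ℕ) (j : ℤ) :
    ‖seqAt g m j - seqAt (fun n => meshPoint δ (nearestSite δ (g n))) m j‖ ≤ δ := by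
  unfold seqAt
  have h1 := dist_meshPoint_nearestSite_le hδ (g (Int.toNat (m + j)))
  rwa [Complex.dist_eq, norm_sub_rev] at h1

/-- **`g_{i,ε²}` is bounded in magnitude by `O(1)`** along a row: if `|g| ≤ 1` then the rounded
row has entries of modulus `≤ 1 + δ`. [cite: TaoFMP2016, §2 (paragraph after the proof of Proposition 2.6)] -/
theorem norm_seqAt_round_le {δ : ℝ} (hδ : 0 < δ) {g : ℕ → ℂ} (hg : ∀ n, ‖g n‖ ≤ 1) (m : ℕ)
    (j : ℤ) : ‖seqAt (fun n => meshPoint δ (nearestSite δ (g n))) m j‖ ≤ 1 + δ := by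
  unfold seqAt
  exact (norm_meshPoint_nearestSite_le hδ _).trans (by linarith [hg (Int.toNat (m + j))])

/-- The row `seqAt g m` is `1`-bounded when `|g| ≤ 1`. [folklore] -/
theorem norm_seqAt_le_one {g : ℕ → ℂ} (hg : ∀ n, ‖g n‖ ≤ 1) (m : ℕ) (j : ℤ) :
    ‖seqAt g m j‖ ≤ 1 := hg _

end Tao2016

end Literature.NumberTheory.LFunctions
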